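import Mathlib
import HarnessLib
import Summits.HubbardSuperconductivity.HubbardSuperconductivity.Theorems.KLProgrammeKLRegimeEngineV8E5WitnessRows
import Summits.HubbardSuperconductivity.HubbardSuperconductivity.Theorems.KLProgrammeKLRegimeFrameShellCount
import Summits.HubbardSuperconductivity.HubbardSuperconductivity.Theorems.KLProgrammeKLRegimeSectorSubEntrySum
import Summits.HubbardSuperconductivity.HubbardSuperconductivity.Theorems.KLProgrammeKLRegimeSectorGramHalfNormSum

/-!
# Route `KLProgramme` — ENGINE child gen 8 (stmt-HubbardSuperconductivity-20437 `KLRegimeEngineV17F2`), SKELETON v2 class #3, PROVING side: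
# the TRIVIAL-FAMILY line data of the two E.5 lines at ANY admissible frame — the Gram half-norms and entries of `h12` (the first steps `n ≤ 2`)
# DISCHARGED from the whole-shell phase-space count (cell gate-hubbard-kl, seat p5 g10; assembly part 8)

WHY.  The class-#3 entry point `exists_e5Pkg2_of_stepDataRows` (…E5WitnessRows) discharges the Gram data of the steps `n ≥ 3` on the FAT family of
level `n−2` (k3c2-p2's `gram_softShaped_bgmFat_sharp_klEng`) but leaves the first steps `n ≤ 2` as the raw hypothesis `h12` through the TRIVIAL
sectorisation (`trivialMultiplier`, one sector), for which no Gram lemma existed.  At the first steps every scale is `O(1)`, so the sectorless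
(BGM (2.80) without sectors: `κ² ≍ Λ`) phase-space count suffices: the number of frequency–momenta in the shell `{r/2 < ρ_K ≤ r}`
(`ρ_K = √(ω² + e_K²)`) is `≤ (rβ/π + 3)·(1793·r·L² + 704·L)` for EVERY admissible frame (k3c4-p1's `card_frameLevel_le_le`, …FrameShellCount) —
`≤ 2288·βL²·r²` once `π/β ≤ r` and `β² ≤ L` (and EMPTY below the temperature floor `π/β`) — and k3c2-p2's dyadic lemmas
(`norm_sq_sectorGramF/G_le_of_dyadic`, `sum_norm_symbol_le_of_dyadic`, `norm_sectorSub_pullback_normalCovariance_le_of_sum`) turn a soft shape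
`‖p‖ ≤ A_p·βL²/ρ_K` with support in `{ρ_K ≤ Λ′}` into `‖F_Y‖², ‖G_Y‖², (βL²)²·|entry|/… ≤ 9152·A_p·Λ′`, floor-uniform.  The two E.5 lines of the
step `n−1 → n` are soft-shaped (`A_p = 256` for the rescaled dressed slice derivative, …E5WitnessRows §9; `A_p = 8` for the dressed soft line,
…E5SoftLineSharp) and supported in `{ρ_K ≤ Λ_{n−1}}` (`klws_deriv_cutoffWeight_scale_eq_zero`, `klE5SoftLineSym_eq_zero_of`).

* §14 `card_filter_klRadius_shell_le` — the whole-shell count `#{k : r/2 < ρ_K(k) ≤ r} ≤ 2288·βL²·r²` (`FrameOK`, `klBetaMin ≤ β`, `β² ≤ L`,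
  `0 < r ≤ 1/32`); `sum_norm_softShaped_trivial_le` — `Σ_{k : p(k,σ) ≠ 0} ‖p(k,σ)‖ ≤ 9152·(A_p·βL²)·(βL²)·Λ′` for a soft-shaped symbol supported
  in `{ρ_K ≤ Λ′}`, `Λ′ ≤ 1/32`;
* §15 **`gram_softShaped_trivial_le`** — for such a symbol, through `trivialMultiplier`: entries `≤ 9152·A_p·Λ′`, `‖F_Y‖, ‖G_{Y′}‖ ≤ √(9152·A_p·Λ′)`;
* §16 **`gram_klE5Lines_trivial`** — the instance for the two E.5 lines of the step `n−1 → n` (`1 ≤ n`, any admissible frame `K`, `Λ ∈ [Λ_n, Λ_{n−1}]`,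
  the dressing smallness (SM)): line `0` = `λ·klE5DerivLineSym … K (n−1) κ Λ` (`λ = Λ_{n−1} − Λ_n`): `‖F_Y‖, ‖G_Y‖ ≤ √(9152·256·Λ_{n−1})`;
  soft line `klE5SoftLineSym … K (n−1) κ Λ`: entries `≤ 9152·8·Λ_{n−1}`, `‖F_Y‖, ‖G_Y‖ ≤ √(9152·8·Λ_{n−1})` — the `hκF₀/hκG₀/hent/hκF₁/hκG₁` of `h12`
  at every `n`, generic dressing `κ` (at `κ := klE5Kappa …` they are the (R1′) lines).

Pure composition + counting arithmetic; no definitions, no named facts, nothing about the model's sizes is asserted; nothing asserts superconductivity.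
-/

noncomputable section

namespace Summit.HubbardSuperconductivity.HubbardSuperconductivity.Theorems.KLRegimeSplit

set_option linter.dupNamespace false -- summit = problem name (single-conjunct summit), D-0017

open Real Finset Literature.MathematicalPhysics.QuantumLattice Literature.Probability.LatticeModels GrassmannAlgebra Matrix
open Literature.MathematicalPhysics.QuantumLattice.FermiRG
open Summit.HubbardSuperconductivity.HubbardSuperconductivity.Theorems.KLProgrammeLegKernels
open Summit.HubbardSuperconductivity.HubbardSuperconductivity.Theorems.KLRegimeWick
open Summit.HubbardSuperconductivity.HubbardSuperconductivity.Theorems.EngineV8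
open Summit.HubbardSuperconductivity.HubbardSuperconductivity.Theorems.TwoPointAssembly
open Summit.HubbardSuperconductivity.HubbardSuperconductivity.Theorems.TorusFourierL2
open Summit.HubbardSuperconductivity.HubbardSuperconductivity.Theorems.DispersionFlow

/-! ## §14 The whole-shell phase-space count at an admissible frame, and the dyadic sum of a soft-shaped symbol -/

section Count

variable {L M : ℕ} [NeZero L] {R : RenConsts} {U : ℝ} {N : ℕ} {μ : ℝ} {K : TrigPolyC4v} {β : ℝ}

omit [NeZero L] in
/-- `|ω| ≤ ρ_K` and `|e_K| ≤ ρ_K`. [folklore] -/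
theorem abs_le_klRadius (β μ : ℝ) (K : TrigPolyC4v) (k : FreqMomentum L M) :
    |matsubaraFreq β M k.1| ≤ Real.sqrt (matsubaraFreq β M k.1 ^ 2 + nambuXiCT L μ K k.2 ^ 2) ∧
      |nambuXiCT L μ K k.2| ≤ Real.sqrt (matsubaraFreq β M k.1 ^ 2 + nambuXiCT L μ K k.2 ^ 2) := by
  constructor
  · rw [← Real.sqrt_sq_eq_abs]
    exact Real.sqrt_le_sqrt (le_add_of_nonneg_right (sq_nonneg _))
  · rw [← Real.sqrt_sq_eq_abs]
    exact Real.sqrt_le_sqrt (le_add_of_nonneg_left (sq_nonneg _))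

omit [NeZero L] in
/-- The temperature floor: `π/β ≤ ρ_K(k)` (`0 < β`). [folklore] -/
theorem pi_div_le_klRadius (hβ : 0 < β) (μ : ℝ) (K : TrigPolyC4v) (k : FreqMomentum L M) :
    Real.pi / β ≤ Real.sqrt (matsubaraFreq β M k.1 ^ 2 + nambuXiCT L μ K k.2 ^ 2) :=
  (pi_div_le_abs_matsubaraFreq hβ k.1).trans (abs_le_klRadius β μ K k).1

/-- **The whole-shell count at an admissible frame**: for `FrameOK R U N μ K`, `klBetaMin ≤ β`, `β² ≤ L` and `0 < r ≤ 1/32`,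
`#{k : r/2 < ρ_K(k) ≤ r} ≤ 2288·βL²·r²` — empty below the floor `π/β`, and `≤ (rβ/π + 3)·(1793·r·L² + 704·L) ≤ (4rβ/π)·1795·r·L²` above it
(`card_filter_matsubaraFreq_le`, `card_frameLevel_le_le`; `704·L ≤ 2·r·L²` from `r·L ≥ πβ ≥ 128π`). [cite: BenfattoGiulianiMastropietro2006, §2.5 (2.50); §2.8 (2.80)] -/
theorem card_filter_klRadius_shell_le [NeZero M] (hK : FrameOK R U N μ K) (hβ : klBetaMin ≤ β) (hL : β ^ 2 ≤ (L : ℝ))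
    {r : ℝ} (hr : 0 < r) (hr32 : r ≤ 1 / 32) :
    ((((univ : Finset (FreqMomentum L M)).filter fun k =>
        r / 2 < Real.sqrt (matsubaraFreq β M k.1 ^ 2 + nambuXiCT L μ K k.2 ^ 2) ∧
          Real.sqrt (matsubaraFreq β M k.1 ^ 2 + nambuXiCT L μ K k.2 ^ 2) ≤ r).card : ℕ) : ℝ) ≤ 2288 * (β * (L : ℝ) ^ 2) * r ^ 2 := by
  classical
  have hβ128 : 128 ≤ β := by simpa [klBetaMin] using hβ
  have hβ0 : 0 < β := by linarith
  have hπ := Real.pi_pos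
  have hπ3 := Real.pi_gt_three
  have hπ314 : 3.14 < Real.pi := Real.pi_gt_d2
  by_cases hrβ : r < Real.pi / β
  · -- below the temperature floor the shell is empty
    have hempty : ((univ : Finset (FreqMomentum L M)).filter fun k =>
        r / 2 < Real.sqrt (matsubaraFreq β M k.1 ^ 2 + nambuXiCT L μ K k.2 ^ 2) ∧
          Real.sqrt (matsubaraFreq β M k.1 ^ 2 + nambuXiCT L μ K k.2 ^ 2) ≤ r) = ∅ := by
      refine filter_eq_empty_iff.2 fun k _ h => ?_
      have := pi_div_le_klRadius (L := L) (M := M) hβ0 μ K k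
      linarith [h.2]
    rw [hempty, card_empty, Nat.cast_zero]
    positivity
  · have hrβ' : Real.pi / β ≤ r := le_of_not_gt hrβ
    have hπrβ : Real.pi ≤ r * β := by rwa [div_le_iff₀ hβ0] at hrβ'
    -- the shell sits inside the box `|ω| ≤ r ∧ |e_K| ≤ r`
    have hsub : ((univ : Finset (FreqMomentum L M)).filter fun k =>
        r / 2 < Real.sqrt (matsubaraFreq β M k.1 ^ 2 + nambuXiCT L μ K k.2 ^ 2) ∧
          Real.sqrt (matsubaraFreq β M k.1 ^ 2 + nambuXiCT L μ K k.2 ^ 2) ≤ r) ⊆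
        (univ : Finset (FreqMomentum L M)).filter fun k => |matsubaraFreq β M k.1| ≤ r ∧ |nambuXiCT L μ K k.2| ≤ r := by
      intro k hk
      rw [mem_filter] at hk ⊢
      have h := abs_le_klRadius (L := L) (M := M) β μ K k
      exact ⟨mem_univ _, h.1.trans hk.2.2, h.2.trans hk.2.2⟩
    have hbox : ((((univ : Finset (FreqMomentum L M)).filter fun k => |matsubaraFreq β M k.1| ≤ r ∧ |nambuXiCT L μ K k.2| ≤ r).card : ℕ) : ℝ) ≤
        (r * β / Real.pi + 3) * (1793 * r * (L : ℝ) ^ 2 + 704 * L) := by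
      rw [card_filter_freqMomentum_eq (fun i : MatsubaraIdx M => |matsubaraFreq β M i| ≤ r) (fun k : TorusSite 2 L => |nambuXiCT L μ K k| ≤ r),
        Nat.cast_mul]
      refine mul_le_mul (card_filter_matsubaraFreq_le hβ0 hr.le _ fun i hi => (mem_filter.1 hi).2)
        (card_frameLevel_le_le (L := L) hK hr.le (by linarith)) (Nat.cast_nonneg _) (by positivity)
    have hcard : ((((univ : Finset (FreqMomentum L M)).filter fun k =>
        r / 2 < Real.sqrt (matsubaraFreq β M k.1 ^ 2 + nambuXiCT L μ K k.2 ^ 2) ∧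
          Real.sqrt (matsubaraFreq β M k.1 ^ 2 + nambuXiCT L μ K k.2 ^ 2) ≤ r).card : ℕ) : ℝ) ≤
        (r * β / Real.pi + 3) * (1793 * r * (L : ℝ) ^ 2 + 704 * L) :=
      (Nat.cast_le.2 (card_le_card hsub)).trans hbox
    refine hcard.trans ?_
    -- arithmetic: `(rβ/π + 3) ≤ 4rβ/π`, `704·L ≤ 2·r·L²`, `4·1795/π ≤ 2288`
    have hL0 : (0 : ℝ) < L := lt_of_lt_of_le (by positivity) hL
    have h1 : r * β / Real.pi + 3 ≤ 4 * (r * β / Real.pi) := by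
      have : 3 ≤ 3 * (r * β / Real.pi) := by
        rw [le_mul_iff_one_le_right (by norm_num : (0 : ℝ) < 3), one_le_div hπ]
        exact hπrβ
      linarith
    have hrL : 352 ≤ r * (L : ℝ) := by
      have hβL : β ≤ (L : ℝ) := by nlinarith
      have : Real.pi * β ≤ r * (L : ℝ) := by
        calc Real.pi * β ≤ r * β * β := by nlinarith
          _ = r * β ^ 2 := by ring
          _ ≤ r * (L : ℝ) := mul_le_mul_of_nonneg_left hL hr.le
      nlinarith
    have h2 : 1793 * r * (L : ℝ) ^ 2 + 704 * L ≤ 1795 * r * (L : ℝ) ^ 2 := by nlinarith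
    have h3 : 4 * (r * β / Real.pi) * (1795 * r * (L : ℝ) ^ 2) ≤ 2288 * (β * (L : ℝ) ^ 2) * r ^ 2 := by
      have e : 4 * (r * β / Real.pi) * (1795 * r * (L : ℝ) ^ 2) = (7180 / Real.pi) * ((β * (L : ℝ) ^ 2) * r ^ 2) := by
        field_simp
        ring
      rw [e, show 2288 * (β * (L : ℝ) ^ 2) * r ^ 2 = 2288 * ((β * (L : ℝ) ^ 2) * r ^ 2) by ring]
      refine mul_le_mul_of_nonneg_right ?_ (by positivity)
      rw [div_le_iff₀ hπ]
      nlinarith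
    calc (r * β / Real.pi + 3) * (1793 * r * (L : ℝ) ^ 2 + 704 * L)
        ≤ 4 * (r * β / Real.pi) * (1795 * r * (L : ℝ) ^ 2) := mul_le_mul h1 h2 (by positivity) (by positivity)
      _ ≤ 2288 * (β * (L : ℝ) ^ 2) * r ^ 2 := h3

/-- **The dyadic sum of a soft-shaped, shell-supported symbol in the TRIVIAL family**: for `FrameOK R U N μ K`, `klBetaMin ≤ β`, `β² ≤ L`,
`0 < Λ′ ≤ 1/32`, a symbol with `‖p(k,σ)‖ ≤ A_p·βL²/ρ_K(k)` and `ρ_K(k) ≤ Λ′` wherever `p(k,σ) ≠ 0` (`0 ≤ A_p`):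
`Σ_{k : p(k,σ) ≠ 0} ‖p(k,σ)‖ ≤ 4·(A_p·βL²)·(2288·βL²)·Λ′`. [cite: BenfattoGiulianiMastropietro2006, §2.8 (2.80)] -/
theorem sum_norm_softShaped_trivial_le [NeZero M] (hK : FrameOK R U N μ K) (hβ : klBetaMin ≤ β) (hL : β ^ 2 ≤ (L : ℝ))
    {Λ' : ℝ} (hΛ' : 0 < Λ') (hΛ'32 : Λ' ≤ 1 / 32) (p : FreqMomentum L M × Fin 2 → ℂ) {Ap : ℝ} (hAp : 0 ≤ Ap) (σ : Fin 2)
    (hp : ∀ k, p (k, σ) ≠ 0 → ‖p (k, σ)‖ ≤ Ap * (β * (L : ℝ) ^ 2) / Real.sqrt (matsubaraFreq β M k.1 ^ 2 + nambuXiCT L μ K k.2 ^ 2))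
    (hsupp : ∀ k, p (k, σ) ≠ 0 → Real.sqrt (matsubaraFreq β M k.1 ^ 2 + nambuXiCT L μ K k.2 ^ 2) ≤ Λ') :
    ∑ k ∈ (univ : Finset (FreqMomentum L M)).filter (fun k => p (k, σ) ≠ 0 ∧ p (k, σ) ≠ 0), ‖p (k, σ)‖ ≤
      4 * (Ap * (β * (L : ℝ) ^ 2)) * (2288 * (β * (L : ℝ) ^ 2)) * Λ' := by
  classical
  have hβ0 : 0 < β := pos_of_klBetaMin_le hβ
  refine sum_norm_symbol_le_of_dyadic (fun k => p (k, σ)) (fun k => p (k, σ))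
    (fun k => Real.sqrt (matsubaraFreq β M k.1 ^ 2 + nambuXiCT L μ K k.2 ^ 2)) hΛ' (by positivity : 0 < Real.pi / β) (by positivity)
    (by positivity) (fun k _ hk => hp k hk) (fun k _ hk => ⟨pi_div_le_klRadius (L := L) (M := M) hβ0 μ K k, hsupp k hk⟩) ?_
  intro r hr hrΛ
  refine le_trans ?_ (card_filter_klRadius_shell_le (L := L) (M := M) hK hβ hL hr (hrΛ.trans hΛ'32))
  exact_mod_cast card_le_card fun k hk => by
    rw [mem_filter] at hk ⊢
    exact ⟨mem_univ _, hk.2⟩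

end Count

/-! ## §15 Gram data of a soft-shaped, shell-supported symbol through the trivial multiplier -/

section Trivial

variable {L M : ℕ} [NeZero L] [NeZero M] {R : RenConsts} {U : ℝ} {N : ℕ} {μ : ℝ} {K : TrigPolyC4v} {β : ℝ}

/-- **Trivial-family line data of a soft-shaped, shell-supported symbol**: under `FrameOK R U N μ K`, `klBetaMin ≤ β`, `β² ≤ L`, `0 < Λ′ ≤ 1/32`, if
`‖p(ks)‖ ≤ A_p·βL²/ρ_K` and `ρ_K ≤ Λ′` wherever `p(ks) ≠ 0`, then through `trivialMultiplier` the entries of `Sᵀ·normalCovariance p·S` are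
`≤ 9152·A_p·Λ′` and both Gram half-norms are `≤ √(9152·A_p·Λ′)` — the sectorless Gram constant `κ² ≍ Λ′` of BGM (2.80), floor-uniform, any admissible frame.
[cite: BenfattoGiulianiMastropietro2006, §2.8 (2.80)] -/
theorem gram_softShaped_trivial_le (hK : FrameOK R U N μ K) (hβ : klBetaMin ≤ β) (hL : β ^ 2 ≤ (L : ℝ))
    {Λ' : ℝ} (hΛ' : 0 < Λ') (hΛ'32 : Λ' ≤ 1 / 32) (p : FreqMomentum L M × Fin 2 → ℂ) {Ap : ℝ} (hAp : 0 ≤ Ap)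
    (hp : ∀ ks, p ks ≠ 0 → ‖p ks‖ ≤ Ap * (β * (L : ℝ) ^ 2) / Real.sqrt (matsubaraFreq β M ks.1.1 ^ 2 + nambuXiCT L μ K ks.1.2 ^ 2))
    (hsupp : ∀ ks, p ks ≠ 0 → Real.sqrt (matsubaraFreq β M ks.1.1 ^ 2 + nambuXiCT L μ K ks.1.2 ^ 2) ≤ Λ') :
    (∀ Y Y' : SpaceTimeIdx L M × SectorLeg 1,
        ‖((sectorSubMatrix L M β (trivialMultiplier L M)).transpose * normalCovariance L M p * sectorSubMatrix L M β (trivialMultiplier L M)) Y Y'‖ ≤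
          9152 * Ap * Λ') ∧
      (∀ Y : SpaceTimeIdx L M × SectorLeg 1, ‖sectorGramF L M β (trivialMultiplier L M) p Y‖ ≤ Real.sqrt (9152 * Ap * Λ')) ∧
      (∀ Y' : SpaceTimeIdx L M × SectorLeg 1, ‖sectorGramG L M β (trivialMultiplier L M) p Y'‖ ≤ Real.sqrt (9152 * Ap * Λ')) := by
  classical
  have hβ0 : 0 < β := pos_of_klBetaMin_le hβ
  have hL0 : (0 : ℝ) < L := lt_of_lt_of_le (by positivity) hL
  have hβL : (0 : ℝ) < β * (L : ℝ) ^ 2 := by positivity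
  have hF : ∀ (ω : Fin 1) (k : FreqMomentum L M), ‖trivialMultiplier L M ω k‖ ≤ 1 := norm_trivialMultiplier_le_one
  -- the normalisation `‖(βL²)⁻¹‖²·(4·(A_p βL²)·(2288 βL²)·Λ′) = 9152·A_p·Λ′`
  have hnorm : ‖((1 / (β * (L : ℝ) ^ 2) : ℝ) : ℂ)‖ ^ 2 * (4 * (Ap * (β * (L : ℝ) ^ 2)) * (2288 * (β * (L : ℝ) ^ 2)) * Λ') = 9152 * Ap * Λ' := by
    rw [Complex.norm_real, Real.norm_eq_abs, abs_of_pos (by positivity), div_pow, one_pow]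
    field_simp
    ring
  -- the dyadic count, shared by entries and half-norms
  have hcount : ∀ (ω : Fin 1) (r : ℝ), 0 < r → r ≤ Λ' →
      ((((univ : Finset (FreqMomentum L M)).filter (fun k => trivialMultiplier L M ω k ≠ 0)).filter fun k =>
          r / 2 < Real.sqrt (matsubaraFreq β M k.1 ^ 2 + nambuXiCT L μ K k.2 ^ 2) ∧
            Real.sqrt (matsubaraFreq β M k.1 ^ 2 + nambuXiCT L μ K k.2 ^ 2) ≤ r).card : ℝ) ≤ 2288 * (β * (L : ℝ) ^ 2) * r ^ 2 := by
    intro ω r hr hrΛ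
    refine le_trans ?_ (card_filter_klRadius_shell_le (L := L) (M := M) hK hβ hL hr (hrΛ.trans hΛ'32))
    exact_mod_cast card_le_card fun k hk => by
      rw [mem_filter] at hk ⊢
      exact ⟨mem_univ _, hk.2⟩
  refine ⟨fun Y Y' => ?_, fun Y => ?_, fun Y' => ?_⟩
  · -- entries: SUM form, then the dyadic sum over the symbol's own support
    refine (norm_sectorSub_pullback_normalCovariance_le_of_sum β _ hF p Y Y').trans ?_
    rw [← hnorm]
    refine mul_le_mul_of_nonneg_left ?_ (pow_nonneg (norm_nonneg _) 2)
    have hsum := sum_norm_softShaped_trivial_le (L := L) (M := M) hK hβ hL hΛ' hΛ'32 p hAp Y.2.1.2 (fun k hk => hp (k, Y.2.1.2) hk)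
      (fun k hk => hsupp (k, Y.2.1.2) hk)
    refine le_trans ?_ hsum
    -- drop the vanishing terms
    rw [← sum_filter_ne_zero ((univ : Finset (FreqMomentum L M)).filter fun k => trivialMultiplier L M Y.2.1.1 k ≠ 0)]
    refine sum_le_sum_of_subset_of_nonneg (fun k hk => ?_) fun _ _ _ => norm_nonneg _
    rw [mem_filter] at hk ⊢
    have hk' : p (k, Y.2.1.2) ≠ 0 := fun h => hk.2 (by rw [h, norm_zero])
    exact ⟨mem_univ _, hk', hk'⟩
  · rw [← Real.sqrt_sq (norm_nonneg (sectorGramF L M β _ p Y))]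
    refine Real.sqrt_le_sqrt ?_
    rw [← hnorm]
    exact norm_sq_sectorGramF_le_of_dyadic β _ hF p Y (fun k => Real.sqrt (matsubaraFreq β M k.1 ^ 2 + nambuXiCT L μ K k.2 ^ 2)) hΛ'
      (by positivity : 0 < Real.pi / β) (by positivity) (by positivity) (fun k _ hk => hp (k, Y.2.1.2) hk)
      (fun k _ hk => ⟨pi_div_le_klRadius (L := L) (M := M) hβ0 μ K k, hsupp (k, Y.2.1.2) hk⟩) (hcount Y.2.1.1)
  · rw [← Real.sqrt_sq (norm_nonneg (sectorGramG L M β _ p Y'))]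
    refine Real.sqrt_le_sqrt ?_
    rw [← hnorm]
    exact norm_sq_sectorGramG_le_of_dyadic β _ hF p Y' (fun k => Real.sqrt (matsubaraFreq β M k.1 ^ 2 + nambuXiCT L μ K k.2 ^ 2)) hΛ'
      (by positivity : 0 < Real.pi / β) (by positivity) (by positivity) (fun k _ hk => hp (k, Y'.2.1.2) hk)
      (fun k _ hk => ⟨pi_div_le_klRadius (L := L) (M := M) hβ0 μ K k, hsupp (k, Y'.2.1.2) hk⟩) (hcount Y'.2.1.1)

end Trivial

/-! ## §16 The two E.5 lines of the step `n−1 → n` through the trivial multiplier -/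

section Lines

variable {L M : ℕ} [NeZero L] [NeZero M] {R : RenConsts} {U : ℝ} {N : ℕ} {μ : ℝ} {K : TrigPolyC4v} {β : ℝ}
  (κ : FreqMomentum L M × Fin 2 → ℂ)

omit [NeZero L] [NeZero M] in
/-- The rescaled dressed slice derivative is supported in the shell of scale `Λ`: `λ·ċ_Λ(ks) ≠ 0 ⇒ ρ_K(ks) ≤ Λ` (`Λ ≠ 0`). [folklore] -/
theorem klRadius_le_of_scaled_klE5DerivLineSym_ne_zero (μ : ℝ) (K : TrigPolyC4v) (n₀ : ℕ) {Λ : ℝ} (hΛ : Λ ≠ 0) (lam : ℝ)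
    (ks : FreqMomentum L M × Fin 2) (h : (lam : ℂ) * klE5DerivLineSym L M β μ K n₀ κ Λ ks ≠ 0) :
    Real.sqrt (matsubaraFreq β M ks.1.1 ^ 2 + nambuXiCT L μ K ks.1.2 ^ 2) ≤ |Λ| := by
  have hd : deriv (fun Λ' : ℝ => hubbardCutoffWeightCT L M β μ K Λ' ks.1) Λ ≠ 0 :=
    deriv_cutoffWeight_ne_zero_of_klE5DerivLineSym_ne_zero L M β μ K n₀ κ Λ ks (right_ne_zero_of_mul h)
  have hle : matsubaraFreq β M ks.1.1 ^ 2 + nambuXiCT L μ K ks.1.2 ^ 2 ≤ Λ ^ 2 := by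
    by_contra hgt
    exact hd (klws_deriv_cutoffWeight_scale_eq_zero L M β μ K hΛ ks.1 (Or.inr (lt_of_not_ge hgt)))
  calc Real.sqrt (matsubaraFreq β M ks.1.1 ^ 2 + nambuXiCT L μ K ks.1.2 ^ 2) ≤ Real.sqrt (Λ ^ 2) := Real.sqrt_le_sqrt hle
    _ = |Λ| := Real.sqrt_sq_eq_abs Λ

omit [NeZero L] [NeZero M] in
/-- The dressed soft line of the step `n₀ → n₀+1` is supported below `Λ_{n₀}`: `klE5SoftLineSym … Λ ks ≠ 0 ⇒ ρ_K(ks) ≤ Λ_{n₀}` for `0 < Λ ≤ Λ_{n₀}`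
(above `Λ_{n₀}` every cutoff weight at a scale `≤ Λ_{n₀}` equals `1`). [folklore] -/
theorem klRadius_le_of_klE5SoftLineSym_ne_zero (μ : ℝ) (K : TrigPolyC4v) (n₀ : ℕ) {Λ : ℝ} (hΛ : 0 < Λ) (hΛn : Λ ≤ klScale klE0 n₀)
    (ks : FreqMomentum L M × Fin 2) (h : klE5SoftLineSym L M β μ K n₀ κ Λ ks ≠ 0) :
    Real.sqrt (matsubaraFreq β M ks.1.1 ^ 2 + nambuXiCT L μ K ks.1.2 ^ 2) ≤ klScale klE0 n₀ := by
  have hn0 : 0 < klScale klE0 n₀ := by unfold klScale klE0; positivity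
  have hn1 : 0 < klScale klE0 (n₀ + 1) := by unfold klScale klE0; positivity
  have hs1 : klScale klE0 (n₀ + 1) ≤ klScale klE0 n₀ := by
    rw [klth_klScale_succ]; linarith [hn0]
  by_contra hgt
  have hgt' : klScale klE0 n₀ < Real.sqrt (matsubaraFreq β M ks.1.1 ^ 2 + nambuXiCT L μ K ks.1.2 ^ 2) := lt_of_not_ge hgt
  have hsq : ∀ Λ' : ℝ, 0 < Λ' → Λ' ≤ klScale klE0 n₀ → Λ' ^ 2 ≤ matsubaraFreq β M ks.1.1 ^ 2 + nambuXiCT L μ K ks.1.2 ^ 2 := by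
      intro Λ' h0 h1
      have h2 : Λ' < Real.sqrt (matsubaraFreq β M ks.1.1 ^ 2 + nambuXiCT L μ K ks.1.2 ^ 2) := lt_of_le_of_lt h1 hgt'
      have h3 : Λ' ^ 2 < Real.sqrt (matsubaraFreq β M ks.1.1 ^ 2 + nambuXiCT L μ K ks.1.2 ^ 2) ^ 2 := by
        exact pow_lt_pow_left₀ h2 h0.le two_ne_zero
      rw [Real.sq_sqrt (by positivity)] at h3
      exact h3.le
  have w0 : hubbardCutoffWeightCT L M β μ K (klScale klE0 n₀) ks.1 = 1 := hubbardCutoffWeightCT_eq_one_of_sq_le β μ K hn0 ks.1 (hsq _ hn0 le_rfl)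
  have w1 : hubbardCutoffWeightCT L M β μ K (klScale klE0 (n₀ + 1)) ks.1 = 1 := hubbardCutoffWeightCT_eq_one_of_sq_le β μ K hn1 ks.1 (hsq _ hn1 hs1)
  have wΛ : hubbardCutoffWeightCT L M β μ K Λ ks.1 = 1 := hubbardCutoffWeightCT_eq_one_of_sq_le β μ K hΛ ks.1 (hsq _ hΛ hΛn)
  exact h (klE5SoftLineSym_eq_zero_of L M β μ K n₀ κ Λ ks w1 (by rw [w1, w0]) (by rw [wΛ, w0]))

/-- **TRIVIAL-FAMILY line data of the two E.5 lines of the step `n−1 → n`** (the `hκF₀/hκG₀/hent/hκF₁/hκG₁` of `h12`, at EVERY `n ≥ 1`, any admissible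
frame `K`, generic dressing `κ`): under `FrameOK R U N μ K`, `klBetaMin ≤ β`, `β² ≤ L`, `Λ ∈ [Λ_n, Λ_{n−1}]` and the dressing smallness at `Λ_n` and `Λ`,
the rescaled dressed slice derivative `λ·klE5DerivLineSym … K (n−1) κ Λ` (`λ = Λ_{n−1} − Λ_n`, soft-shaped with `A_p = 256`) has Gram half-norms
`≤ √(9152·256·Λ_{n−1})`, and the dressed soft line `klE5SoftLineSym … K (n−1) κ Λ` (`A_p = 8`) has entries `≤ 9152·8·Λ_{n−1}` and Gram half-norms
`≤ √(9152·8·Λ_{n−1})`. [cite: BenfattoGiulianiMastropietro2006, §2.8 (2.80)] -/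
theorem gram_klE5Lines_trivial (hK : FrameOK R U N μ K) (hβ : klBetaMin ≤ β) (hL : β ^ 2 ≤ (L : ℝ)) {n : ℕ} (hn : 1 ≤ n)
    {Λ : ℝ} (hΛ : Λ ∈ Set.Icc (klScale klE0 n) (klScale klE0 (n - 1)))
    (hsm : ∀ ks : FreqMomentum L M × Fin 2, ‖klE5SliceSym L M β μ K (n - 1) (klScale klE0 n) ks * κ ks‖ ≤ 1 / 2 ∧
      ‖klE5SliceSym L M β μ K (n - 1) Λ ks * κ ks‖ ≤ 1 / 2) :
    (∀ Y : SpaceTimeIdx L M × SectorLeg 1, ‖sectorGramF L M β (trivialMultiplier L M)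
        (fun ks => ((klScale klE0 (n - 1) - klScale klE0 n : ℝ) : ℂ) * klE5DerivLineSym L M β μ K (n - 1) κ Λ ks) Y‖ ≤
          Real.sqrt (9152 * 256 * klScale klE0 (n - 1))) ∧
      (∀ Y' : SpaceTimeIdx L M × SectorLeg 1, ‖sectorGramG L M β (trivialMultiplier L M)
        (fun ks => ((klScale klE0 (n - 1) - klScale klE0 n : ℝ) : ℂ) * klE5DerivLineSym L M β μ K (n - 1) κ Λ ks) Y'‖ ≤
          Real.sqrt (9152 * 256 * klScale klE0 (n - 1))) ∧
      (∀ Y Y' : SpaceTimeIdx L M × SectorLeg 1,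
        ‖((sectorSubMatrix L M β (trivialMultiplier L M)).transpose * normalCovariance L M (klE5SoftLineSym L M β μ K (n - 1) κ Λ) *
            sectorSubMatrix L M β (trivialMultiplier L M)) Y Y'‖ ≤ 9152 * 8 * klScale klE0 (n - 1)) ∧
      (∀ Y : SpaceTimeIdx L M × SectorLeg 1, ‖sectorGramF L M β (trivialMultiplier L M) (klE5SoftLineSym L M β μ K (n - 1) κ Λ) Y‖ ≤
          Real.sqrt (9152 * 8 * klScale klE0 (n - 1))) ∧
      (∀ Y' : SpaceTimeIdx L M × SectorLeg 1, ‖sectorGramG L M β (trivialMultiplier L M) (klE5SoftLineSym L M β μ K (n - 1) κ Λ) Y'‖ ≤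
          Real.sqrt (9152 * 8 * klScale klE0 (n - 1))) := by
  have hβpos : 0 < β := pos_of_klBetaMin_le hβ
  have hβ0 : 0 ≤ β := hβpos.le
  have hΛn : 0 < klScale klE0 n := by unfold klScale klE0; positivity
  have hΛ0 : 0 < Λ := lt_of_lt_of_le hΛn hΛ.1
  have hΛtop : 0 < klScale klE0 (n - 1) := by unfold klScale klE0; positivity
  have hΛtop32 : klScale klE0 (n - 1) ≤ 1 / 32 := by
    unfold klScale klE0
    have : (1 : ℝ) ≤ 4 ^ (n - 1) := one_le_pow₀ (by norm_num)
    exact mul_le_of_le_one_right (by norm_num) (inv_le_one_of_one_le₀ this)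
  -- the slice measure `λ = 3Λ_n ≤ 3Λ`
  have hlam : klScale klE0 (n - 1) - klScale klE0 n = 3 * klScale klE0 n := by
    rw [klScale_pred_sub_eq klE0 hn, klScale]; ring
  have hlam0 : 0 ≤ klScale klE0 (n - 1) - klScale klE0 n := by rw [hlam]; positivity
  have hlam3 : klScale klE0 (n - 1) - klScale klE0 n ≤ 3 * Λ := by rw [hlam]; exact mul_le_mul_of_nonneg_left hΛ.1 (by norm_num)
  have hsm' : ∀ ks : FreqMomentum L M × Fin 2,
      ‖klE5SliceSym L M β μ K (n - 1) (klScale klE0 (n - 1 + 1)) ks * κ ks‖ ≤ 1 / 2 := by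
    rw [Nat.sub_add_cancel hn]; exact fun ks => (hsm ks).1
  -- line 0
  obtain ⟨-, hF₀, hG₀⟩ := gram_softShaped_trivial_le (L := L) (M := M) hK hβ hL hΛtop hΛtop32
    (fun ks => ((klScale klE0 (n - 1) - klScale klE0 n : ℝ) : ℂ) * klE5DerivLineSym L M β μ K (n - 1) κ Λ ks) (by norm_num : (0:ℝ) ≤ 256)
    (fun ks _ => norm_scaled_klE5DerivLineSym_le_div_radius β μ K (n - 1) κ hβ0 hΛ0 hlam0 hlam3 ks (hsm ks).2)
    (fun ks hks => ((klRadius_le_of_scaled_klE5DerivLineSym_ne_zero (L := L) (M := M) (β := β) κ μ K (n - 1) hΛ0.ne' _ ks hks).trans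
      (by rw [abs_of_pos hΛ0]; exact hΛ.2)))
  -- soft line
  obtain ⟨hent, hF₁, hG₁⟩ := gram_softShaped_trivial_le (L := L) (M := M) hK hβ hL hΛtop hΛtop32
    (klE5SoftLineSym L M β μ K (n - 1) κ Λ) (by norm_num : (0:ℝ) ≤ 8)
    (fun ks _ => norm_klE5SoftLineSym_le_div_radius (L := L) (M := M) β μ K (n - 1) κ hβ0 ks (hsm' ks) (hsm ks).2)
    (fun ks hks => klRadius_le_of_klE5SoftLineSym_ne_zero (L := L) (M := M) (β := β) κ μ K (n - 1) hΛ0 hΛ.2 ks hks)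
  exact ⟨hF₀, hG₀, hent, hF₁, hG₁⟩

end Lines

end Summit.HubbardSuperconductivity.HubbardSuperconductivity.Theorems.KLRegimeSplit

end
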